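import Literature.MathematicalPhysics.QuantumLattice.HubbardHubbardModelEtaODLROProofs

/-!
# Crux `TwSeededEnsembleEquivalence` (stmt-HubbardSuperconductivity-1698), line `exposed-density-duality` —
# stub `stub_singlyOccupiedTrialState` (structural barrier, B3)

For the ATOMIC-LIMIT Hubbard torus (`t = 0`) with the on-site `s`-wave seed,
`HsCan = hubbardTorus 2 L 0 U − (g/L²)(pairField sWave L)ᴴ(pairField sWave L)`, and every
`N ≤ L²`, the fully spin-polarised occupation basis state `|S × {↑}⟩` (`S` any set of `N` sites)
is a unit `N`-particle vector annihilated by `HsCan`: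

* there is no hopping (`t = 0`);
* the interaction `U Σ_x n_{x↑} n_{x↓}` vanishes on it (`n_{x↓} = c†_{x↓} c_{x↓}` and no down
  orbital is occupied);
* every summand `c_{X↑} c_{Y↓}` resp. `c_{X↓} c_{Y↑}` of the pair field `pairField g L` kills any
  vector supported on configurations without down electrons (a down annihilator acts either
  first, or after an up annihilator, which keeps the support free of down electrons); hence
  `P ψ = 0` and `(PᴴP) ψ = Pᴴ (P ψ) = 0`. No property of the form factor is used.

Elementary facts about the Jordan–Wigner matrices of wave 0 (`Fock ι = Finset ι → ℂ`,
`PosSemidefTrace.annihilation_mulVec_apply`); no definitions are introduced.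
-/

set_option linter.dupNamespace false

namespace Summit.HubbardSuperconductivity.HubbardSuperconductivity.Theorems.TwSeededEnsembleEquivalence.ExposedDensity

open Matrix Finset Literature.MathematicalPhysics.QuantumLattice Literature.Probability.LatticeModels
open scoped ComplexOrder Matrix.Norms.L2Operator

noncomputable section

section NoDown

variable {Λ : Type*} [LinearOrder Λ] [Fintype Λ]

/-- A down-spin annihilator `c_{y↓}` kills every Fock vector supported on configurations without
down electrons (`(c_i φ)(s) = ± φ(s ∪ {i})` for `i ∉ s`). [folklore] -/
theorem annihilation_orb_one_mulVec_of_noDown {φ : Fock (Orb Λ)}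
    (hφ : ∀ (s : Finset (Orb Λ)) (x : Λ), orb x 1 ∈ s → φ s = 0) (y : Λ) :
    annihilation (orb y 1) *ᵥ φ = 0 := by
  ext s
  rw [PosSemidefTrace.annihilation_mulVec_apply, Pi.zero_apply]
  by_cases h : orb y 1 ∈ s
  · rw [if_neg (not_not_intro h)]
  · rw [if_pos h, hφ _ y (Finset.mem_insert_self _ _), mul_zero]

/-- An up-spin annihilator `c_{y↑}` maps vectors supported on configurations without down
electrons to vectors of the same kind. [folklore] -/
theorem noDown_annihilation_orb_zero_mulVec {φ : Fock (Orb Λ)}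
    (hφ : ∀ (s : Finset (Orb Λ)) (x : Λ), orb x 1 ∈ s → φ s = 0) (y : Λ) :
    ∀ (s : Finset (Orb Λ)) (x : Λ), orb x 1 ∈ s → (annihilation (orb y 0) *ᵥ φ) s = 0 := by
  intro s x hx
  rw [PosSemidefTrace.annihilation_mulVec_apply]
  by_cases h : orb y 0 ∈ s
  · rw [if_neg (not_not_intro h)]
  · rw [if_pos h, hφ _ x (Finset.mem_insert_of_mem hx), mul_zero]

/-- Each singlet summand `c_{X↑} c_{Y↓} − c_{X↓} c_{Y↑}` of a local pair operator kills every vector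
supported on configurations without down electrons. [folklore] -/
theorem singletPair_mulVec_of_noDown {φ : Fock (Orb Λ)}
    (hφ : ∀ (s : Finset (Orb Λ)) (x : Λ), orb x 1 ∈ s → φ s = 0) (X Y : Λ) :
    (annihilation (orb X 0) * annihilation (orb Y 1) -
        annihilation (orb X 1) * annihilation (orb Y 0)) *ᵥ φ = 0 := by
  rw [sub_mulVec, ← mulVec_mulVec, ← mulVec_mulVec, annihilation_orb_one_mulVec_of_noDown hφ Y,
    mulVec_zero, annihilation_orb_one_mulVec_of_noDown (noDown_annihilation_orb_zero_mulVec hφ Y) X,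
    sub_zero]

/-- The down-spin number operator `n_{x↓} = c†_{x↓} c_{x↓}` kills every vector supported on
configurations without down electrons. [folklore] -/
theorem numberOp_one_mulVec_of_noDown {φ : Fock (Orb Λ)}
    (hφ : ∀ (s : Finset (Orb Λ)) (x : Λ), orb x 1 ∈ s → φ s = 0) (x : Λ) :
    numberOp x 1 *ᵥ φ = 0 := by
  unfold numberOp
  rw [← mulVec_mulVec, annihilation_orb_one_mulVec_of_noDown hφ x, mulVec_zero]

/-- The Hubbard interaction `Σ_x n_{x↑} n_{x↓}` kills every vector supported on configurations
without down electrons. [folklore] -/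
theorem interaction_mulVec_of_noDown {φ : Fock (Orb Λ)}
    (hφ : ∀ (s : Finset (Orb Λ)) (x : Λ), orb x 1 ∈ s → φ s = 0) :
    (∑ x : Λ, numberOp x 0 * numberOp x 1) *ᵥ φ = 0 := by
  rw [sum_mulVec]
  refine Finset.sum_eq_zero fun x _ => ?_
  rw [← mulVec_mulVec, numberOp_one_mulVec_of_noDown hφ x, mulVec_zero]

/-- The atomic-limit (`t = 0`) Hubbard Hamiltonian on any graph kills every vector supported on
configurations without down electrons. [folklore] -/
theorem hamiltonian_zero_mulVec_of_noDown (G : SimpleGraph Λ) [DecidableRel G.Adj] (U : ℝ)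
    {φ : Fock (Orb Λ)} (hφ : ∀ (s : Finset (Orb Λ)) (x : Λ), orb x 1 ∈ s → φ s = 0) :
    hamiltonian G 0 U *ᵥ φ = 0 := by
  rw [hamiltonian, Complex.ofReal_zero, neg_zero, zero_smul, zero_add, smul_mulVec,
    interaction_mulVec_of_noDown hφ, smul_zero]

end NoDown

section Torus

variable (g : Site 2 → ℝ) (L : ℕ) [NeZero L]

/-- The pair field `pairField g L` (any form factor) kills every vector supported on
configurations without down electrons. [folklore] -/
theorem pairField_mulVec_of_noDown {φ : Fock (Orb (FermionTorus 2 L))}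
    (hφ : ∀ (s : Finset (Orb (FermionTorus 2 L))) (x : FermionTorus 2 L), orb x 1 ∈ s → φ s = 0) :
    pairField g L *ᵥ φ = 0 := by
  rw [pairField, sum_mulVec]
  refine Finset.sum_eq_zero fun x _ => ?_
  rw [localPair, sum_mulVec]
  refine Finset.sum_eq_zero fun e _ => ?_
  rw [smul_mulVec, singletPair_mulVec_of_noDown hφ, smul_zero]

/-- The seeded atomic-limit Hamiltonian `hubbardTorus 2 L 0 U − (g'/L²) PᴴP` (`P = pairField g L`)
kills every vector supported on configurations without down electrons. [folklore] -/
theorem seededAtomic_mulVec_of_noDown (U c : ℝ) {φ : Fock (Orb (FermionTorus 2 L))}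
    (hφ : ∀ (s : Finset (Orb (FermionTorus 2 L))) (x : FermionTorus 2 L), orb x 1 ∈ s → φ s = 0) :
    (hubbardTorus 2 L 0 U - (c : ℂ) • ((pairField g L)ᴴ * pairField g L)) *ᵥ φ = 0 := by
  rw [sub_mulVec, smul_mulVec, ← mulVec_mulVec, pairField_mulVec_of_noDown g L hφ, mulVec_zero,
    smul_zero, sub_zero, hubbardTorus, hamiltonian_zero_mulVec_of_noDown _ U hφ]

end Torus

/-- **Stub B3 (`stub_singlyOccupiedTrialState`).** For `N ≤ L²` there is a unit `N`-particle
vector annihilated by the seeded atomic-limit Hamiltonian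
`hubbardTorus 2 L 0 U − (g/L²)(pairField sWave L)ᴴ(pairField sWave L)`: the occupation basis
state `|S × {↑}⟩` with `S` a set of `N` sites (no down electron, hence no doubly occupied site,
no interaction energy, and it is killed by every term of the pair field). [folklore] -/
theorem stub_singlyOccupiedTrialState :
    ∀ (L : ℕ) [NeZero L] (U g : ℝ) (N : ℕ), N ≤ L ^ 2 →
      ∃ ψ : Fock (Orb (FermionTorus 2 L)), star ψ ⬝ᵥ ψ = 1 ∧ IsNParticle N ψ ∧
        (hubbardTorus 2 L 0 U - ((g / (L : ℝ) ^ 2 : ℝ) : ℂ) • ((pairField sWave L)ᴴ * pairField sWave L)) *ᵥ ψ = 0 := by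
  intro L _ U g N hN
  -- a set `S` of `N` sites
  obtain ⟨S, -, hS⟩ : ∃ S ⊆ (Finset.univ : Finset (FermionTorus 2 L)), S.card = N :=
    Finset.exists_subset_card_eq (by rwa [Finset.card_univ, card_fermionTorus])
  -- the polarised configuration `S × {↑}`
  obtain ⟨s₀, hs₀⟩ : ∃ s₀ : Finset (Orb (FermionTorus 2 L)),
      s₀ = S.map ⟨fun x => orb x 0, fun x y h => (orb_eq_orb_iff.1 h).1⟩ := ⟨_, rfl⟩
  have hcard : s₀.card = N := by rw [hs₀, Finset.card_map, hS]
  have hno : ∀ x : FermionTorus 2 L, orb x 1 ∉ s₀ := by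
    intro x hx
    rw [hs₀, Finset.mem_map] at hx
    obtain ⟨y, -, hy⟩ := hx
    exact absurd (orb_eq_orb_iff.1 hy).2 (by decide)
  refine ⟨Pi.single s₀ 1, ?_, ?_, ?_⟩
  · rw [← Pi.single_star, star_one, single_dotProduct, one_mul, Pi.single_eq_same]
  · intro s hs
    exact Pi.single_eq_of_ne (fun h => hs (by rw [h, hcard])) _
  · -- `|s₀⟩` is supported on configurations without down electrons
    refine seededAtomic_mulVec_of_noDown sWave L U _ fun s x hx => ?_
    exact Pi.single_eq_of_ne (fun hs : s = s₀ => hno x (hs ▸ hx)) _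

end

end Summit.HubbardSuperconductivity.HubbardSuperconductivity.Theorems.TwSeededEnsembleEquivalence.ExposedDensity
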